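import Literature.NumberTheory.EllipticCurves.IwasawaLocalKummerSkeletonProofs
import Literature.NumberTheory.EllipticCurves.BinaryQuarticFiniteFieldSolubilityProofs
import HarnessLib

/-!
# A Kummer count kills `H¹(G, A₁)[p^∞]`: if the `A₁[p]`-valued cocycle classes are no more
# numerous than `p · #A₁^G[p]` and `A₁^G` has a non-divisible direction, every
# `A₁ ∩ A[p^m]`-valued cocycle is an `A₁`-coboundary (row T-T3B, file F2; generic)

HONEST FRAMING (cell `b2b-bsdres`, run/shared/lean/b2b/bsd-rank1-residual/, verbatim in every
file): the goal of the cell is to DELETE the COMBINATION-SHAPED residual classes of the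
Birch–Swinnerton-Dyer formula for ALL analytic-rank `≤ 1` elliptic curves over `ℚ` — "full BSD
formula for every rank `≤ 1` curve in class `C`" assembled STRICTLY from published theorems — so
that the rank-`≤ 1` remainder becomes exactly the CONSTRUCTION-SHAPED classes, which are TYPED
(missing-input `Prop`s), NOT attempted. This is not "finishing BSD". Team n1011 (N10/N11; row
T-T3B = the `v = p` local tower kernel at level `0` for additive potentially good ordinary
reduction, skeleton `cells/n1011/skel/T-T3B.md`): research routes on CONSTRUCTION-SHAPED classes;
prove what is provable now; no claim beyond stated classes; census output = EVIDENCE, never a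
Literature fact; RESIDUAL-MAP marks UNCHANGED; nothing is booked by this file. TOOL THEOREMS ONLY:
no definition, no named fact, nothing cited enters as a hypothesis.

## What (generic topological-group cohomology; no arithmetic)

`G` a topological group, `A` a discrete `G`-module with continuous orbit maps, `A₁ ≤ A` a
`G`-stable `p`-divisible subgroup ("`E₁(K̄_v)`, the kernel of reduction of a good model at
`v ∣ p`"; `A₁[p^∞] = C` the canonical line), `Q = A₁^G = A₁ ∩ A^G` ("`E₁(K_v)`"), `T = Q[p^∞]`.
The Kummer sequence `0 → A₁[p] → A₁ → A₁ → 0` gives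
`Q/pQ ↪ H¹(G, A₁[p]) ↠ H¹(G, A₁)[p]` (Greenberg, LNM 1716 §2 p. 71, the local Kummer map `κ_M`
restricted to the formal group; Silverman *AEC* VIII §2). Hence:

* §1 `exists_eq_coboundary_of_pow_smul` — **Step D**: if every `A₁[p]`-valued cocycle is `∂a`
  with `a ∈ A₁`, so is every `A₁ ∩ A[p^m]`-valued cocycle (induction on `m`, dividing inside `A₁`).
* §2 `forall_exists_eq_coboundary_of_card_le` — **the count**: if the `A₁[p]`-valued cocycles fall
  into a finite set `S` of classes modulo `∂(A₁[p])` with `#S ≤ p · #Q[p]`, `T` is finite, and some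
  `u ∈ Q` lies outside `pQ + T` (a "non-divisible direction": `E₁(K_v) ≅ ℤ_p × T` has one), then
  every `A₁[p]`-valued cocycle is `∂a`, `a ∈ A₁`. Proof: the Kummer classes `∂b`, `p b = j u + r`
  (`0 ≤ j < p`, `r` running over representatives of `T/pT`, `#T/pT = #T[p] = #Q[p]` by the tree's
  `BinaryQuartic.natCard_quotient_range_eq_natCard_ker`) are pairwise
  inequivalent modulo `∂(A₁[p])` (an equivalence gives `j u + r − j' u − r' ∈ pQ`, forcing `j = j'`
  by the choice of `u` and then `r ≡ r' (mod pT)`), so they exhaust `S` by pigeonhole, and every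
  class in `S` — hence every `A₁[p]`-valued cocycle — is a Kummer class, i.e. an `A₁`-coboundary.
* §3 `oneCocycleClass_eq_zero_of_kerValued` — assembly: under the hypotheses of §2 every
  `A₁ ∩ A[p^m]`-valued cocycle has trivial class in `H¹(G, A)` (indeed is `∂a`, `a ∈ A₁`).

In Greenberg's Lemma 3.4 (LNM 1716 p. 89) for a GOOD ORDINARY curve the same count leaves the
index `[Im λ : Im κ] = #Ẽ(𝔽_p)(p)`; the row T-T3B applies it to the TWISTED formal group of an
additive potentially good ordinary curve, where `#H¹(ℚ_p, C[p]) = p · #C[p]^G` exactly (Tate's local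
Euler–Poincaré characteristic + local duality + a ramified line character: files F3–F5).

References: [GreenbergLNM1716] R. Greenberg, LNM 1716 (1999), §2 p. 71 (Kummer sequence), §3
Lemma 3.4 (p. 89); [SilvermanAEC2009] J. H. Silverman, *AEC* 2nd ed., VIII §2.
-/

noncomputable section

open scoped Classical

open CategoryTheory Literature.NumberTheory.EllipticCurves Literature.NumberTheory.GaloisRepresentations
  Literature.NumberTheory.EllipticCurves.ResKernel

universe u

namespace Summit.BirchSwinnertonDyer.Rank1Residual.Iwasawa

namespace KummerCount

variable {G : Type u} [Group G] [TopologicalSpace G]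
variable {A : Type u} [AddCommGroup A] [DistribMulAction G A] [TopologicalSpace A]
  [DiscreteTopology A]

/-! ## §0 Divisibility bookkeeping inside `A₁` -/

omit [TopologicalSpace G] [TopologicalSpace A] [DiscreteTopology A] [DistribMulAction G A] in
/-- Iterated `p`-divisibility inside a `p`-divisible subgroup. [folklore] -/
theorem exists_pow_smul_eq_mem (p : ℕ) (A₁ : AddSubgroup A)
    (hdiv₁ : ∀ a ∈ A₁, ∃ b ∈ A₁, p • b = a) (k : ℕ) {a : A} (ha : a ∈ A₁) :
    ∃ b ∈ A₁, p ^ k • b = a := by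
  induction k generalizing a with
  | zero => exact ⟨a, ha, by rw [pow_zero, one_smul]⟩
  | succ k ih =>
    obtain ⟨b, hb, rfl⟩ := hdiv₁ a ha
    obtain ⟨c, hc, rfl⟩ := ih hb
    exact ⟨c, hc, by rw [pow_succ, mul_comm, mul_smul]⟩

/-! ## §1 Step D: from `A₁[p]`-valued to `A₁ ∩ A[p^m]`-valued cocycles -/

/-- **Step D.** If every `A₁[p]`-valued continuous cocycle of the discrete `G`-module `A` is the
coboundary of an element of the `p`-divisible subgroup `A₁`, then so is every cocycle with values
in `A₁ ∩ A[p^m]`: `p^m ψ` is `A₁[p]`-valued, hence `= ∂a₁`; dividing `a₁ = p^m b₁` inside `A₁`,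
`ψ − ∂b₁` is `A₁ ∩ A[p^m]`-valued... (induction on `m`). This is `H¹(G, A₁)[p] = 0 ⟹
H¹(G, A₁)[p^∞] = 0` on cocycles. Greenberg, LNM 1716, §2 p. 71 (the Kummer sequence for the formal
group). [cite: GreenbergLNM1716, §2 (p. 71)] -/
theorem exists_eq_coboundary_of_pow_smul (hcont : ∀ a : A, Continuous fun g : G ↦ g • a)
    (p : ℕ) (A₁ : AddSubgroup A)
    (hA₁ : ∀ (g : G) (a : A), a ∈ A₁ → g • a ∈ A₁)
    (hdiv₁ : ∀ a ∈ A₁, ∃ b ∈ A₁, p • b = a)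
    (hbase : ∀ ψ : contOneCocycles (discreteTopRep G A), (∀ g, ψ.1 g ∈ A₁) →
      (∀ g, p • ψ.1 g = 0) → ∃ a ∈ A₁, ∀ g, ψ.1 g = g • a - a) (m : ℕ) :
    ∀ ψ : contOneCocycles (discreteTopRep G A), (∀ g, ψ.1 g ∈ A₁) →
      (∀ g, p ^ m • ψ.1 g = 0) → ∃ a ∈ A₁, ∀ g, ψ.1 g = g • a - a := by
  induction m with
  | zero =>
    intro ψ _ h0
    refine ⟨0, A₁.zero_mem, fun g ↦ ?_⟩
    have h := h0 g
    rw [pow_zero, one_smul] at h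
    rw [h, smul_zero, sub_self]
  | succ m ih =>
    intro ψ hψ₁ hψp
    -- `χ = p^m • ψ` is `A₁[p]`-valued
    have hχv : ∀ g, (((p ^ m : ℕ) : ℤ) • ψ).1 g = p ^ m • ψ.1 g := fun g ↦ by
      rw [coe_zsmul_cocycle_apply, Nat.cast_smul_eq_nsmul]
    obtain ⟨a₁, ha₁, hχa⟩ := hbase (((p ^ m : ℕ) : ℤ) • ψ)
      (fun g ↦ by rw [hχv]; exact A₁.nsmul_mem (hψ₁ g) _)
      (fun g ↦ by rw [hχv, smul_smul, ← pow_succ', hψp g])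
    -- divide `a₁` by `p^m` inside `A₁`
    obtain ⟨b₁, hb₁, hpb₁⟩ := exists_pow_smul_eq_mem p A₁ hdiv₁ m ha₁
    -- `ψ' = ψ - ∂b₁` is `A₁ ∩ A[p^m]`-valued
    obtain ⟨a₂, ha₂, hψ'⟩ := ih (ψ - cobCocycle b₁ (hcont b₁))
      (fun g ↦ by
        rw [Submodule.coe_sub, ContinuousMap.sub_apply, cobCocycle_apply]
        exact A₁.sub_mem (hψ₁ g) (A₁.sub_mem (hA₁ g b₁ hb₁) hb₁))
      (fun g ↦ by
        rw [Submodule.coe_sub, ContinuousMap.sub_apply, cobCocycle_apply, smul_sub, ← hχv, hχa g,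
          smul_sub, smul_comm, hpb₁, sub_self])
    refine ⟨b₁ + a₂, A₁.add_mem hb₁ ha₂, fun g ↦ ?_⟩
    have h := hψ' g
    rw [Submodule.coe_sub, ContinuousMap.sub_apply, cobCocycle_apply, sub_eq_iff_eq_add] at h
    rw [h, smul_add]
    abel

/-! ## §2 The count: Kummer classes exhaust the `A₁[p]`-valued cocycle classes -/

/-- **The count.** Let `A₁ ≤ A` be `G`-stable and `p`-divisible (`p` prime), `Q = A₁ ∩ A^G`,
`T = Q[p^∞]` finite, and `u ∈ Q` with `u ∉ pQ + T` (`hu`). Suppose the `A₁[p]`-valued continuous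
cocycles of `A` fall into a finite set `S` of representatives modulo coboundaries of elements of
`A₁[p]`, with `#S ≤ p · #Q[p]`. Then every `A₁[p]`-valued cocycle is `∂a` with `a ∈ A₁`. Proof: for
`0 ≤ j < p` and `r` running over representatives of `T/pT` (`#(T/pT) = #T[p] = #Q[p]`) pick
`b ∈ A₁` with `p b = j u + r`; the cocycles `∂b` are `A₁[p]`-valued and pairwise inequivalent modulo
`∂(A₁[p])` (an equivalence `∂b − ∂b' = ∂t` makes `c = b − b' − t ∈ Q` with `p c = (j−j') u + (r − r')`;
if `j ≠ j'` then `(j − j')` is invertible mod `p` and `u ∈ pQ + T`, contradiction; so `j = j'`,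
`r − r' = p c ∈ pT`, `r = r'`), so `(j, r) ↦` (the `S`-representative of `∂b`) is injective, hence
bijective (`p · #T/pT ≥ #S`); thus every representative, and so every `A₁[p]`-valued cocycle, is
`∂b + ∂t = ∂(b + t)` with `b + t ∈ A₁`. This is the surjectivity of the Kummer map
`Q/pQ → H¹(G, A₁[p])` by counting (`#Q/pQ ≥ p · #Q[p] ≥ #H¹`), i.e. `H¹(G, A₁)[p] = 0`.
Greenberg, LNM 1716, §2 p. 71 and §3 Lemma 3.4 (p. 89: the index of `Im κ` in `Im λ`).
[cite: GreenbergLNM1716, §2 (p. 71) and §3 Lemma 3.4 (p. 89)] -/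
theorem forall_exists_eq_coboundary_of_card_le (hcont : ∀ a : A, Continuous fun g : G ↦ g • a)
    (p : ℕ) [hp : Fact p.Prime] (A₁ : AddSubgroup A)
    (hA₁ : ∀ (g : G) (a : A), a ∈ A₁ → g • a ∈ A₁)
    (hdiv₁ : ∀ a ∈ A₁, ∃ b ∈ A₁, p • b = a)
    (hTfin : Set.Finite {a : A | a ∈ A₁ ∧ (∀ g : G, g • a = a) ∧ ∃ k : ℕ, p ^ k • a = 0})
    {u : A} (hu₁ : u ∈ A₁) (huG : ∀ g : G, g • u = u)
    (hu : ∀ c t : A, c ∈ A₁ → (∀ g : G, g • c = c) → t ∈ A₁ → (∀ g : G, g • t = t) →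
      (∃ k : ℕ, p ^ k • t = 0) → u ≠ p • c + t)
    (S : Finset (contOneCocycles (discreteTopRep G A)))
    (hS : S.card ≤ p * Nat.card {a : A // a ∈ A₁ ∧ (∀ g : G, g • a = a) ∧ p • a = 0})
    (hrep : ∀ ψ : contOneCocycles (discreteTopRep G A), (∀ g, ψ.1 g ∈ A₁) →
      (∀ g, p • ψ.1 g = 0) → ∃ ψ₀ ∈ S, ∃ t ∈ A₁, p • t = 0 ∧ ∀ g, ψ.1 g - ψ₀.1 g = g • t - t)
    (ψ : contOneCocycles (discreteTopRep G A)) (hψ₁ : ∀ g, ψ.1 g ∈ A₁)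
    (hψp : ∀ g, p • ψ.1 g = 0) : ∃ a ∈ A₁, ∀ g, ψ.1 g = g • a - a := by
  -- the subgroup `T = Q[p^∞]`
  let T : AddSubgroup A :=
    { carrier := {a : A | a ∈ A₁ ∧ (∀ g : G, g • a = a) ∧ ∃ k : ℕ, p ^ k • a = 0}
      zero_mem' := ⟨A₁.zero_mem, fun g ↦ smul_zero g, 0, smul_zero _⟩
      add_mem' := by
        rintro a b ⟨ha₁, haG, k, hk⟩ ⟨hb₁, hbG, l, hl⟩
        refine ⟨A₁.add_mem ha₁ hb₁, fun g ↦ by rw [smul_add, haG, hbG], k + l, ?_⟩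
        rw [smul_add, pow_add, mul_comm, mul_smul, hk, smul_zero, zero_add, mul_comm, mul_smul,
          hl, smul_zero]
      neg_mem' := by
        rintro a ⟨ha₁, haG, k, hk⟩
        exact ⟨A₁.neg_mem ha₁, fun g ↦ by rw [smul_neg, haG], k, by rw [smul_neg, hk, neg_zero]⟩ }
  have hmemT : ∀ a : A, a ∈ T ↔ a ∈ A₁ ∧ (∀ g : G, g • a = a) ∧ ∃ k : ℕ, p ^ k • a = 0 :=
    fun a ↦ Iff.rfl
  haveI : Finite T := Set.Finite.to_subtype hTfin
  -- multiplication by `p` on `T`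
  let φ : T →+ T :=
    { toFun := fun t ↦ ⟨p • (t : A), T.nsmul_mem t.2 p⟩
      map_zero' := Subtype.ext (by simp)
      map_add' := fun a b ↦ Subtype.ext (by simp [smul_add]) }
  have hφ : ∀ t : T, ((φ t : T) : A) = p • (t : A) := fun t ↦ rfl
  -- `#(T/pT) = #T[p] = #Q[p]`
  have hker : Nat.card φ.ker = Nat.card {a : A // a ∈ A₁ ∧ (∀ g : G, g • a = a) ∧ p • a = 0} := by
    refine Nat.card_congr ⟨fun t ↦ ⟨(t.1 : A), t.1.2.1, t.1.2.2.1, ?_⟩, fun a ↦ ⟨⟨a.1, a.2.1, a.2.2.1,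
      1, by rw [pow_one]; exact a.2.2.2⟩, ?_⟩, fun t ↦ ?_, fun a ↦ ?_⟩
    · have h := t.2
      rw [AddMonoidHom.mem_ker] at h
      exact congrArg Subtype.val h
    · rw [AddMonoidHom.mem_ker]
      exact Subtype.ext a.2.2.2
    · rfl
    · rfl
  have hquot : Nat.card (T ⧸ φ.range) = Nat.card φ.ker :=
    Literature.NumberTheory.EllipticCurves.BinaryQuartic.natCard_quotient_range_eq_natCard_ker φ
  haveI : Finite (T ⧸ φ.range) := inferInstance
  -- Kummer data for `e(j, q) = j • u + rep q`
  let rep : T ⧸ φ.range → T := Quotient.out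
  have hrep_mk : ∀ q : T ⧸ φ.range, (QuotientAddGroup.mk (rep q) : T ⧸ φ.range) = q :=
    fun q ↦ QuotientAddGroup.out_eq' q
  let e : Fin p × (T ⧸ φ.range) → A := fun jq ↦ (jq.1 : ℕ) • u + ((rep jq.2 : T) : A)
  have he₁ : ∀ jq, e jq ∈ A₁ := fun jq ↦ A₁.add_mem (A₁.nsmul_mem hu₁ _) (rep jq.2).2.1
  have heG : ∀ jq (g : G), g • e jq = e jq := fun jq g ↦ by
    change g • ((jq.1 : ℕ) • u + ((rep jq.2 : T) : A)) = (jq.1 : ℕ) • u + ((rep jq.2 : T) : A)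
    rw [smul_add, smul_comm, huG, (rep jq.2).2.2.1 g]
  choose b hb₁ hpb using fun jq ↦ hdiv₁ (e jq) (he₁ jq)
  have hδ₁ : ∀ jq (g : G), (cobCocycle (b jq) (hcont (b jq))).1 g ∈ A₁ := fun jq g ↦ by
    rw [cobCocycle_apply]; exact A₁.sub_mem (hA₁ g _ (hb₁ jq)) (hb₁ jq)
  have hδp : ∀ jq (g : G), p • (cobCocycle (b jq) (hcont (b jq))).1 g = 0 := fun jq g ↦ by
    rw [cobCocycle_apply, smul_sub, smul_comm, hpb, heG, sub_self]
  choose f hfS t ht₁ htp hft using fun jq ↦ hrep (cobCocycle (b jq) (hcont (b jq))) (hδ₁ jq) (hδp jq)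
  -- `f` is injective
  have hf : Function.Injective f := by
    rintro ⟨j, q⟩ ⟨j', q'⟩ hjj
    -- `c = b - b' - (t - t') ∈ Q` with `p c = e - e'`
    set c : A := b (j, q) - b (j', q') - (t (j, q) - t (j', q')) with hc
    have hc₁ : c ∈ A₁ := A₁.sub_mem (A₁.sub_mem (hb₁ _) (hb₁ _)) (A₁.sub_mem (ht₁ _) (ht₁ _))
    have hcG : ∀ g : G, g • c = c := by
      intro g
      have h1 := hft (j, q) g
      have h2 := hft (j', q') g
      rw [hjj] at h1
      rw [cobCocycle_apply] at h1 h2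
      -- (g b - b) - f g = g t - t ; (g b' - b') - f g = g t' - t'
      have h3 : g • b (j, q) - b (j, q) - (g • b (j', q') - b (j', q')) =
          g • t (j, q) - t (j, q) - (g • t (j', q') - t (j', q')) := by
        rw [← h1, ← h2]; abel
      rw [hc, smul_sub, smul_sub, smul_sub]
      rw [sub_eq_sub_iff_add_eq_add] at h3
      -- rearrange
      have : g • b (j, q) - g • b (j', q') - (g • t (j, q) - g • t (j', q')) -
          (b (j, q) - b (j', q') - (t (j, q) - t (j', q'))) = 0 := by
        have h4 : g • b (j, q) - b (j, q) - (g • b (j', q') - b (j', q')) -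
            (g • t (j, q) - t (j, q) - (g • t (j', q') - t (j', q'))) = 0 := by
          rw [sub_eq_zero]; exact sub_eq_sub_iff_add_eq_add.mpr h3
        rw [← h4]; abel
      exact sub_eq_zero.mp this
    have hpc : p • c = (((j : ℕ) : ℤ) - ((j' : ℕ) : ℤ)) • u +
        (((rep q : T) : A) - ((rep q' : T) : A)) := by
      rw [hc, smul_sub, smul_sub, hpb, hpb, smul_sub, htp, htp, sub_zero, sub_zero]
      change (j : ℕ) • u + ((rep q : T) : A) - ((j' : ℕ) • u + ((rep q' : T) : A)) = _
      rw [sub_smul, ← natCast_zsmul u (j : ℕ), ← natCast_zsmul u (j' : ℕ)]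
      abel
    -- case analysis on `j = j'`
    by_cases hj : j = j'
    · subst hj
      rw [sub_self, zero_smul, zero_add] at hpc
      -- `c ∈ T` and `rep q - rep q' = φ c ∈ range φ`
      have hcT : c ∈ T := by
        obtain ⟨k, hk⟩ := (T.sub_mem (rep q).2 (rep q').2).2.2
        refine ⟨hc₁, hcG, k + 1, ?_⟩
        rw [pow_succ, mul_smul, hpc]
        exact hk
      have hrange : (rep q : T) - rep q' ∈ φ.range := ⟨⟨c, hcT⟩, Subtype.ext (by
        rw [hφ, AddSubgroup.coe_sub]; exact hpc)⟩
      have hqq : q = q' := by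
        rw [← hrep_mk q, ← hrep_mk q', QuotientAddGroup.eq_iff_sub_mem]
        -- membership of `-rep q' + rep q`? use the `sub` form
        exact hrange
      rw [hqq]
    · exfalso
      -- `d = j - j'` is invertible mod `p`
      set d : ℤ := ((j : ℕ) : ℤ) - ((j' : ℕ) : ℤ) with hd
      have hd0 : d ≠ 0 := by
        intro h0
        apply hj
        apply Fin.ext
        have : ((j : ℕ) : ℤ) = ((j' : ℕ) : ℤ) := by rw [hd] at h0; linarith
        exact_mod_cast this
      have hdlt : d.natAbs < p := by
        have hj1 := j.2
        have hj2 := j'.2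
        rw [hd]
        omega
      have hcop : IsCoprime d (p : ℤ) := by
        rw [Int.isCoprime_iff_gcd_eq_one]
        have hdvd : (Int.gcd d p : ℤ) ∣ (p : ℤ) := Int.gcd_dvd_right _ _
        have hdvd' : Int.gcd d p ∣ p := by exact_mod_cast hdvd
        rcases (Nat.dvd_prime hp.out).mp hdvd' with h1 | h2
        · exact h1
        · exfalso
          have hpd : (p : ℤ) ∣ d := by
            rw [← h2]; exact Int.gcd_dvd_left _ _
          have := Int.eq_zero_of_dvd_of_natAbs_lt_natAbs hpd (by
            rw [Int.natAbs_natCast]; exact hdlt)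
          exact hd0 this
      obtain ⟨α, β, hαβ⟩ := hcop
      -- `u = p • (α • c + β • u) + (-α) • (r - r')`
      have hrr : ((rep q : T) : A) - ((rep q' : T) : A) ∈ T := T.sub_mem (rep q).2 (rep q').2
      apply hu (α • c + β • u) ((-α) • (((rep q : T) : A) - ((rep q' : T) : A)))
        (A₁.add_mem (A₁.zsmul_mem hc₁ α) (A₁.zsmul_mem hu₁ β))
        (fun g ↦ by rw [smul_add, smul_comm g α c, hcG, smul_comm g β u, huG])
        (T.zsmul_mem hrr (-α)).1 (T.zsmul_mem hrr (-α)).2.1 (T.zsmul_mem hrr (-α)).2.2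
      -- the computation
      have hdu : d • u = p • c - (((rep q : T) : A) - ((rep q' : T) : A)) := by
        rw [hpc]; abel
      calc u = (α * d + β * (p : ℤ)) • u := by rw [hαβ, one_smul]
        _ = α • (d • u) + β • ((p : ℤ) • u) := by rw [add_smul, mul_smul, mul_smul]
        _ = p • (α • c + β • u) + (-α) • (((rep q : T) : A) - ((rep q' : T) : A)) := by
          rw [hdu, natCast_zsmul, smul_add, smul_sub, smul_comm α p c, smul_comm β p u, neg_smul]
          abel
  -- `f` is a bijection onto `S`
  let f' : Fin p × (T ⧸ φ.range) → S := fun jq ↦ ⟨f jq, hfS jq⟩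
  have hf' : Function.Injective f' := fun a b h ↦ hf (congrArg Subtype.val h)
  haveI : Fintype (T ⧸ φ.range) := Fintype.ofFinite _
  have hcard_le : Fintype.card S ≤ Fintype.card (Fin p × (T ⧸ φ.range)) := by
    rw [Fintype.card_coe, Fintype.card_prod, Fintype.card_fin, Fintype.card_eq_nat_card, hquot,
      hker]
    exact hS
  have hbij : Function.Bijective f' :=
    (Fintype.bijective_iff_injective_and_card f').mpr
      ⟨hf', le_antisymm (Fintype.card_le_of_injective f' hf') hcard_le⟩
  -- conclude for `ψ`
  obtain ⟨ψ₀, hψ₀S, t₀, ht₀₁, -, hψt₀⟩ := hrep ψ hψ₁ hψp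
  obtain ⟨jq, hjq⟩ := hbij.2 ⟨ψ₀, hψ₀S⟩
  have hjq' : f jq = ψ₀ := congrArg Subtype.val hjq
  refine ⟨b jq + (t₀ - t jq), A₁.add_mem (hb₁ jq) (A₁.sub_mem ht₀₁ (ht₁ jq)), fun g ↦ ?_⟩
  have h1 := hψt₀ g
  have h2 := hft jq g
  rw [hjq', cobCocycle_apply] at h2
  -- ψ g = ψ₀ g + (g t₀ - t₀) ; ψ₀ g = (g b - b) - (g t - t)
  have h3 : ψ.1 g = ψ₀.1 g + (g • t₀ - t₀) := by rw [← h1]; abel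
  have h4 : ψ₀.1 g = g • b jq - b jq - (g • t jq - t jq) := by rw [← h2]; abel
  rw [h3, h4, smul_add, smul_sub]
  abel

/-! ## §3 Assembly -/

/-- **`H¹(G, A₁)[p^∞] = 0` on cocycles, hence in `H¹(G, A)`.** Under the hypotheses of
`forall_exists_eq_coboundary_of_card_le` (a `G`-stable `p`-divisible `A₁ ≤ A`, `T = A₁^G[p^∞]`
finite, a non-divisible direction `u ∈ A₁^G`, and the count `#S ≤ p · #A₁^G[p]` of the
`A₁[p]`-valued cocycle classes), every continuous cocycle with values in `A₁ ∩ A[p^m]` is `∂a` with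
`a ∈ A₁`; in particular its class in `H¹(G, A)` vanishes. With file F1
(`ResKernelPrimary.exists_kerValued_cocycle_of_pow_smul_eq_zero`) this kills the `p`-power
torsion of `ker (H¹(G, A) → H¹(N, A))`. [cite: GreenbergLNM1716, §3 Lemma 3.4 (p. 89)] -/
theorem oneCocycleClass_eq_zero_of_kerValued [IsTopologicalGroup G]
    (hcont : ∀ a : A, Continuous fun g : G ↦ g • a)
    (p : ℕ) [hp : Fact p.Prime] (A₁ : AddSubgroup A)
    (hA₁ : ∀ (g : G) (a : A), a ∈ A₁ → g • a ∈ A₁)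
    (hdiv₁ : ∀ a ∈ A₁, ∃ b ∈ A₁, p • b = a)
    (hTfin : Set.Finite {a : A | a ∈ A₁ ∧ (∀ g : G, g • a = a) ∧ ∃ k : ℕ, p ^ k • a = 0})
    {u : A} (hu₁ : u ∈ A₁) (huG : ∀ g : G, g • u = u)
    (hu : ∀ c t : A, c ∈ A₁ → (∀ g : G, g • c = c) → t ∈ A₁ → (∀ g : G, g • t = t) →
      (∃ k : ℕ, p ^ k • t = 0) → u ≠ p • c + t)
    (S : Finset (contOneCocycles (discreteTopRep G A)))
    (hS : S.card ≤ p * Nat.card {a : A // a ∈ A₁ ∧ (∀ g : G, g • a = a) ∧ p • a = 0})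
    (hrep : ∀ ψ : contOneCocycles (discreteTopRep G A), (∀ g, ψ.1 g ∈ A₁) →
      (∀ g, p • ψ.1 g = 0) → ∃ ψ₀ ∈ S, ∃ t ∈ A₁, p • t = 0 ∧ ∀ g, ψ.1 g - ψ₀.1 g = g • t - t)
    {m : ℕ} (ψ : contOneCocycles (discreteTopRep G A)) (hψ₁ : ∀ g, ψ.1 g ∈ A₁)
    (hψm : ∀ g, p ^ m • ψ.1 g = 0) :
    (∃ a ∈ A₁, ∀ g, ψ.1 g = g • a - a) ∧ oneCocycleClass _ ψ = 0 := by
  have h := exists_eq_coboundary_of_pow_smul hcont p A₁ hA₁ hdiv₁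
    (forall_exists_eq_coboundary_of_card_le hcont p A₁ hA₁ hdiv₁ hTfin hu₁ huG hu S hS hrep) m ψ
    hψ₁ hψm
  refine ⟨h, ?_⟩
  obtain ⟨a, -, ha⟩ := h
  exact (oneCocycleClass_eq_zero_iff _ _).mpr ⟨a, fun g ↦ ha g⟩

end KummerCount

end Summit.BirchSwinnertonDyer.Rank1Residual.Iwasawa

end
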